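import Summits.Parity.BatemanHorn.Theorems.SelbergDelangeRigidityLSDRealSegmentTailsAux
import Literature.NumberTheory.Sieve.NairTenenbaumShortSums
import HarnessLib

/-!
# Route `SelbergDelangeRigidity`, crux `LSDRealSegment` (stmt-Parity-9770), line
# `product-anatomy-subcritical`: the peeled tilt is of Nair–Tenenbaum class `𝓜` (helper of `stub_tails`)

`stub_tails` for a general Bateman–Horn system (a member of degree `≥ 2`, or `k ≥ 2`) needs two published facts
that are not proved in the tree: (NT) Nair–Tenenbaum, Acta Math. 180 (1998), Theorem 1 / Corollary 3 — in the
tree as the NAMED FACT `Literature.NumberTheory.Sieve.NairTenenbaum1998_corollary3` (short sums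
`Σ_{x<n≤x+y} ∏ⱼ Fⱼ(|Qⱼ(n)|)` for `Fⱼ` of class `𝓜(A, B, ε)` = `Literature.NumberTheory.Sieve.IsClassM`) —, and
(R) the `p`-adic Thue–Siegel–Roth theorem
(`Literature.NumberTheory.DiophantineApproximation.BugeaudEvertseGyory2018_SPartPolynomialValues`).
The un-capped tilt `m ↦ y^{Ω(m)}` (`1 < y < 2`) is NOT of class `𝓜` (`y^{Ω(2^ν)} = (2^ν)^{log₂ y}` violates
`f(m) ≤ B m^ε` for `ε < log₂ y`), which is why (R) and a peeling of the small primes are needed at all; this file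
proves that the PEELED tilt `m ↦ y^{Ω_{>P}(m)}`, `Ω_{>P}(m) := Ω(m / smoothPart P m)` (the prime factors `> P`
counted with multiplicity), IS of class `𝓜(y, 1, ε)` as soon as `P^ε ≥ y` (`tails_peeledWeight_isClassM`,
registered helper) — the form in which (NT) is consumed by the line (with `Fⱼ = y^{Ω_{>P}}` for every `j`).
-/

open Filter Finset Polynomial
open scoped BigOperators Topology Classical

namespace Summit.Parity.BatemanHorn.Cruxes.LSDRealSegment.ProductAnatomySubcritical

open Literature.NumberTheory.Sieve
open ArithmeticFunction (cardFactors)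
noncomputable section

/-! ### The rough part `m / smoothPart P m` and the peeled weight -/

/-- Every prime factor of `m / smoothPart P m` (`m ≥ 1`) exceeds `P`. [folklore] -/
theorem lt_of_dvd_div_smoothPart {P : ℝ} {m q : ℕ} (hm : m ≠ 0) (hq : q.Prime) (hdvd : q ∣ m / smoothPart P m) :
    P < q := by
  by_contra hle
  have hle : (q : ℝ) ≤ P := not_lt.mp hle
  have hs : smoothPart P m ∣ m := smoothPart_dvd P m
  have hqm : q ∣ m := hdvd.trans (Nat.div_dvd_of_dvd hs)
  set v := m.factorization q with hv
  have hpow : q ^ v ∣ smoothPart P m := by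
    unfold smoothPart Finsupp.prod
    have hmem : q ∈ m.factorization.support := by
      rw [Nat.support_factorization]
      exact Nat.mem_primeFactors.mpr ⟨hq, hqm, hm⟩
    have := Finset.dvd_prod_of_mem (fun p : ℕ => if (p : ℝ) ≤ P then p ^ m.factorization p else 1) hmem
    simpa [hle] using this
  have hmul : q ^ (v + 1) ∣ m := by
    rw [pow_succ, ← Nat.mul_div_cancel' hs]
    exact mul_dvd_mul hpow hdvd
  have := (hq.pow_dvd_iff_le_factorization hm).mp hmul
  omega

/-- `P^{Ω(r)} ≤ r` when every prime factor of `r ≥ 1` exceeds `P ≥ 0`. [folklore] -/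
theorem pow_cardFactors_le_self {P : ℝ} (hP : 0 ≤ P) {r : ℕ} (hr : r ≠ 0) (h : ∀ q, q.Prime → q ∣ r → P ≤ q) :
    P ^ cardFactors r ≤ (r : ℝ) := by
  have key : ∀ l : List ℕ, (∀ q ∈ l, P ≤ q) → P ^ l.length ≤ ((l.prod : ℕ) : ℝ) := by
    intro l
    induction l with
    | nil => intro; simp
    | cons q l ih =>
      intro hl
      rw [List.length_cons, pow_succ, List.prod_cons, Nat.cast_mul]
      have h1 := hl q (by simp)
      have h2 := ih fun r hr => hl r (by simp [hr])
      calc P ^ l.length * P = P * P ^ l.length := mul_comm _ _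
        _ ≤ q * ((l.prod : ℕ) : ℝ) := mul_le_mul h1 h2 (pow_nonneg hP _) (hP.trans h1)
  rw [ArithmeticFunction.cardFactors_apply]
  conv_rhs => rw [← Nat.prod_primeFactorsList hr]
  exact key _ fun q hq => h q (Nat.prime_of_mem_primeFactorsList hq) (Nat.dvd_of_mem_primeFactorsList hq)

/-- The rough part is multiplicative: `(ab)/s(ab) = (a/s(a)) (b/s(b))` for `a, b ≥ 1`. [folklore] -/
theorem div_smoothPart_mul (P : ℝ) {a b : ℕ} (ha : a ≠ 0) (hb : b ≠ 0) :
    a * b / smoothPart P (a * b) = a / smoothPart P a * (b / smoothPart P b) := by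
  rw [smoothPart_mul P ha hb, Nat.div_mul_div_comm (smoothPart_dvd P a) (smoothPart_dvd P b)]

/-- The rough part of `m ≥ 1` is `≥ 1`. [folklore] -/
theorem div_smoothPart_ne_zero (P : ℝ) {m : ℕ} (hm : m ≠ 0) : m / smoothPart P m ≠ 0 :=
  (Nat.div_pos (Nat.le_of_dvd (Nat.pos_of_ne_zero hm) (smoothPart_dvd P m))
    (Nat.pos_of_ne_zero fun h => hm (Nat.eq_zero_of_zero_dvd (h ▸ smoothPart_dvd P m)))).ne'

/-- `Ω(m / s(m)) ≤ Ω(m)`. [folklore] -/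
theorem cardFactors_div_smoothPart_le (P : ℝ) {m : ℕ} (hm : m ≠ 0) :
    cardFactors (m / smoothPart P m) ≤ cardFactors m := by
  have hs := smoothPart_dvd P m
  have hs0 : smoothPart P m ≠ 0 := fun h => hm (Nat.eq_zero_of_zero_dvd (h ▸ hs))
  conv_rhs => rw [← Nat.div_mul_cancel hs]
  rw [ArithmeticFunction.cardFactors_mul (div_smoothPart_ne_zero P hm) hs0]
  exact Nat.le_add_right _ _

/-- **tails_peeledWeight_isClassM** (registered helper of `stub_tails`, line `product-anatomy-subcritical`): the
PEELED tilt `m ↦ y^{Ω(m / smoothPart P m)}` (prime factors `> P` counted with multiplicity) lies in the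
Nair–Tenenbaum class `𝓜(y, 1, ε)` (`Literature.NumberTheory.Sieve.IsClassM`) whenever `y ≥ 1`, `P ≥ 1` and
`y ≤ P^ε`: it is multiplicative (`(ab)/s(ab) = (a/s(a))(b/s(b))`), `≤ y^{Ω(m)}`, and
`y^{Ω_{>P}(m)} ≤ (P^ε)^{Ω_{>P}(m)} ≤ m^ε`. [folklore] -/
theorem tails_peeledWeight_isClassM : ∀ (y ε P : ℝ), 1 ≤ y → 0 < ε → 1 ≤ P → y ≤ P ^ ε →
    Literature.NumberTheory.Sieve.IsClassM y 1 ε (fun m => y ^ cardFactors (m / smoothPart P m)) := by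
  intro y ε P hy hε hP hyP
  have hy0 : 0 ≤ y := by linarith
  have hP0 : 0 ≤ P := by linarith
  refine Literature.NumberTheory.Sieve.isClassM_of_mul_of_le (fun m => pow_nonneg hy0 _) ?_ ?_ ?_
  · intro m n hmn
    rcases eq_or_ne m 0 with rfl | hm
    · obtain rfl : n = 1 := by simpa using hmn
      simp
    rcases eq_or_ne n 0 with rfl | hn
    · obtain rfl : m = 1 := by simpa using hmn
      simp
    show y ^ cardFactors (m * n / smoothPart P (m * n)) =
      y ^ cardFactors (m / smoothPart P m) * y ^ cardFactors (n / smoothPart P n)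
    rw [div_smoothPart_mul P hm hn, ArithmeticFunction.cardFactors_mul (div_smoothPart_ne_zero P hm)
      (div_smoothPart_ne_zero P hn), pow_add]
  · intro m hm
    exact pow_le_pow_right₀ hy (cardFactors_div_smoothPart_le P (by omega))
  · intro m hm
    have hm0 : m ≠ 0 := by omega
    have hr0 := div_smoothPart_ne_zero P hm0
    have h1 : y ^ cardFactors (m / smoothPart P m) ≤ (P ^ ε) ^ cardFactors (m / smoothPart P m) :=
      pow_le_pow_left₀ hy0 hyP _
    have h2 : (P ^ ε) ^ cardFactors (m / smoothPart P m) ≤ ((m / smoothPart P m : ℕ) : ℝ) ^ ε := by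
      rw [← Real.rpow_natCast, ← Real.rpow_mul hP0, mul_comm, Real.rpow_mul hP0, Real.rpow_natCast]
      exact Real.rpow_le_rpow (pow_nonneg hP0 _)
        (pow_cardFactors_le_self hP0 hr0 fun q hq hqd => (lt_of_dvd_div_smoothPart hm0 hq hqd).le) hε.le
    have h3 : ((m / smoothPart P m : ℕ) : ℝ) ^ ε ≤ ((m : ℕ) : ℝ) ^ ε :=
      Real.rpow_le_rpow (Nat.cast_nonneg _) (by exact_mod_cast Nat.div_le_self _ _) hε.le
    show y ^ cardFactors (m / smoothPart P m) ≤ 1 * ((m : ℕ) : ℝ) ^ ε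
    rw [one_mul]
    exact h1.trans (h2.trans h3)

end

end Summit.Parity.BatemanHorn.Cruxes.LSDRealSegment.ProductAnatomySubcritical
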